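import Summits.HodgeConjecture.HodgeConjecture.Theorems.NikulinTwinTransportRealMultiplicationSqrtTwoAlgebraic

/-!
# Route NikulinTwinTransport · `RealMultiplicationGlue` (stmt-HodgeConjecture-13681) —
# the glue from markings and the Hodge types of `H²(K3)` alone: `e = ½ (Ξ₁ − Ξ₂)`

The route's glue item `RealMultiplicationGlue := TwinSimilitudeAlgebraic → HodgeIsometryAlgebraic →
TwinExists → LefschetzOneOneK3 → RealMultiplicationSqrtTwoAlgebraic` (Varesco 2023 Thm. 2.1 /
Rem. 2.2 with the twin in place of the Nikulin quotient). The sibling files reduce it to X at the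
pair `(S, S)` plus three named facts and ONE inline debt — divisor correspondences (D), or fibre
integration (FI) (`realMultiplicationGlue_of_divisorCorrespondences`, `…_of_fibreIntegral`). This
file removes BOTH the inline debt and the coniveau fact:

* THE MIRROR TRICK (`realMultiplicationSqrtTwoAlgebraic_of_marking_of_hodgeTypes`). With the Witt
  correction `ν̃` of `exists_ratCorrection` (`Ξ₁ := e + ν̃` a rational Hodge `2`-similitude of
  `H²(S)`), the MIRROR `Ξ₂ := −e + ν̃ = Ξ₁ − 2e` is ALSO a rational Hodge `2`-similitude:
  `(Ξ₂x.Ξ₂y) = (Ξ₁x.Ξ₁y)` because the cross terms `(ex.ν̃y)`, `(ν̃x.ey)` vanish (`e` is self-adjoint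
  and kills the divisor classes `η⁻¹bᵢ` spanning the image of `ν̃`; `cupProduct_neg_add_correction_eq`).
  On `T` the two similitudes are `±ε` (the only Hodge `2`-similitudes in `ℚ(ε)`), on `NS` both are
  `ν`. X at `(S, S)` makes `Ξ₁ = [γ₁]_*` and `Ξ₂ = [γ₂]_*`, so `e = ½(Ξ₁ − Ξ₂) = [½(γ₁ − γ₂)]_*`
  (`induced_sub`, `induced_smul`). No divisor correspondence, no composition or transpose of
  correspondences, no Buskin, no twin is needed.
* NO CONIVEAU FACT. The type bookkeeping needs the correction classes `η⁻¹aᵢ, η⁻¹bᵢ ∈ NS` to be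
  orthogonal to `σ, σ̄` (`σ` the `(2,0)`-class). Instead of `N¹H² ⊆ H^{1,1}` (Grothendieck 1969) we
  use `e` itself: `eσ = λσ` (`h^{2,0} = 1`), `eσ̄ = λσ̄` (the same `λ`, by self-adjointness and
  `(σ.σ̄) ≠ 0`), and `λ (d.σ) = (d.eσ) = (ed.σ) = 0` for `d ∈ NS`. If `λ ≠ 0` this is the needed
  orthogonality. If `λ = 0` then every `ex` is orthogonal to `σ, σ̄`, i.e. of type `(1,1)`, hence
  (for rational `x`) algebraic by LEFSCHETZ `(1,1)` — the glue's fourth hypothesis, used here — so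
  `e ∘ e = 0`; with `e² = 2` on `NS^⊥` this forces `NS^⊥ = 0`, and `ex ∈ NS^⊥` for every `x`
  (`e` self-adjoint, `e|_{NS} = 0`), so `e = 0 = [0]_*`.

Result: `realMultiplicationGlue_of_marking_of_hodgeTypes : Huybrechts_K3_marking_exists →
Huybrechts_K3_hodgeTypes_H2 → RealMultiplicationGlue` — the item's decl CONDITIONAL on exactly the
two named K3 facts of `Literature/AlgebraicGeometry/Surfaces/{K3Marking,K3HodgeTypes}.lean`
(markings `H²(S,ℤ) ≅ Λ_{K3}` with the cup form, Huybrechts Ch. 1 Prop. 3.5; Hodge types of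
`H²(K3)`, Ch. 6 Prop. 1.2), and likewise `assembly_of_squareGlue_of_marking_of_hodgeTypes` for
the frame item. The marking cannot be dispensed with: the Witt step needs the isometry class of
`(H²(S,ℚ), ∪)`, which none of X, Buskin, the universal twin (similitudes between DIFFERENT
surfaces) or Lefschetz `(1,1)` supplies.
Prover seat prover-pitem-stmt-HodgeConjecture-13681-0.
-/

noncomputable section

namespace Summit.HodgeConjecture.HodgeConjecture.Theorems.NikulinTwinTransport

open scoped Manifold
open CategoryTheory MonoidalCategory
open Literature.AlgebraicGeometry.Motives Literature.AlgebraicGeometry.HodgeTheory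
open Literature.AlgebraicGeometry.Surfaces Literature.Geometry.Kaehler
open Literature.AlgebraicTopology.SingularHomology

/-! ### Two generic lemmas -/

/-- Classes of Hodge type `(p, q)` are stable under negation (same Hodge model; `H^{p,q}` is a
subspace). [folklore] -/
theorem isOfHodgeType_neg {n : ℕ} {X : SchemeOver ℂ} {k p q : ℕ} {c : complexBetti X k}
    (hc : IsOfHodgeType n X k p q c) : IsOfHodgeType n X k p q (-c) := by
  obtain ⟨A, hA⟩ := hc
  exact ⟨A, by rw [map_neg]; exact Submodule.neg_mem _ hA⟩

section Marked

variable {S : SchemeOver ℂ}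

/-- **The mirror similitude.** For a cup-self-adjoint `e` and a correction
`ν̃ x = Σᵢ (ηx.aᵢ) η⁻¹bᵢ` whose value classes `η⁻¹bᵢ` are killed by `e`, the mirror `−e + ν̃` has the
same cup products as `e + ν̃`: `((−e+ν̃)x ∪ (−e+ν̃)y) = ((e+ν̃)x ∪ (e+ν̃)y)`, since the cross terms
`(ex ∪ ν̃y) = Σᵢ (ηy.aᵢ)(x ∪ e η⁻¹bᵢ) = 0` and `(ν̃x ∪ ey) = 0` vanish. [folklore] -/
theorem cupProduct_neg_add_correction_eq
    (η : complexBetti S (2 * 1) ≃ₗ[ℂ] (K3Index → ℂ))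
    (e ν : complexBetti S (2 * 1) →ₗ[ℂ] complexBetti S (2 * 1))
    (he_adj : ∀ x y : complexBetti S (2 * 1),
      cupProduct (rfl : 2 * 1 + 2 * 1 = 2 * 2) (e x) y = cupProduct (rfl : 2 * 1 + 2 * 1 = 2 * 2) x (e y))
    {m : ℕ} (a b : Fin m → K3Index → ℚ)
    (hν : ∀ x, ν x = ∑ i, k3Form (η x) (fun j => (a i j : ℂ)) • η.symm (fun j => (b i j : ℂ)))
    (heb : ∀ i, e (η.symm fun j => (b i j : ℂ)) = 0)
    (x y : complexBetti S (2 * 1)) :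
    cupProduct (rfl : 2 * 1 + 2 * 1 = 2 * 2) ((-e + ν) x) ((-e + ν) y) =
      cupProduct (rfl : 2 * 1 + 2 * 1 = 2 * 2) ((e + ν) x) ((e + ν) y) := by
  have h1 : cupProduct (rfl : 2 * 1 + 2 * 1 = 2 * 2) (e x) (ν y) = 0 := by
    rw [hν y, map_sum]
    refine Finset.sum_eq_zero fun i _ => ?_
    rw [LinearMap.map_smul, he_adj, heb i, map_zero, smul_zero]
  have h2 : cupProduct (rfl : 2 * 1 + 2 * 1 = 2 * 2) (ν x) (e y) = 0 := by
    rw [hν x, map_sum, LinearMap.sum_apply]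
    refine Finset.sum_eq_zero fun i _ => ?_
    rw [LinearMap.map_smul₂, ← he_adj, heb i, map_zero, LinearMap.zero_apply, smul_zero]
  simp only [LinearMap.add_apply, LinearMap.neg_apply, map_add, map_neg, LinearMap.add_apply,
    LinearMap.neg_apply, h1, h2, neg_zero, add_zero, neg_neg]

/-! ### The reduction without divisor correspondences and without the coniveau fact -/

/-- **Real multiplication by `√2` on ONE projective K3 surface `S` is algebraic, granted: the
rational Hodge `2`-similitudes of `H²(S)` ITSELF are algebraic (X at the pair `(S, S)` only),
Lefschetz `(1,1)` on `S`, markings, and the Hodge types of `H²(K3)`.** With a marking `η`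
(`Huybrechts_K3_marking_exists`) and `σ = η⁻¹x₀` the `(2,0)`-class: `eσ = λσ` and `eσ̄ = λσ̄` with
one `λ` (self-adjointness, `(σ.σ̄) ≠ 0`). CASE `λ = 0`: every `ex` is orthogonal to `σ, σ̄`, so of
type `(1,1)` (`Huybrechts_K3_hodgeTypes_H2`), so algebraic for rational `x` (Lefschetz `(1,1)`), so
killed by `e`; rational classes span, hence `e ∘ e = 0`, hence `NS^⊥ = 0` (`e² = 2` there) and
`e = 0 = [0]_*` (`ex ∈ NS^⊥`). CASE `λ ≠ 0`: `NS ⊥ σ, σ̄` (`λ(d.σ) = (ed.σ) = 0`), so the Witt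
correction `ν̃ = Σᵢ (η·.aᵢ) η⁻¹bᵢ` of `exists_ratCorrection` (`η⁻¹aᵢ, η⁻¹bᵢ ∈ NS`) makes BOTH
`Ξ₁ = e + ν̃` and its mirror `Ξ₂ = −e + ν̃` rational, type-preserving `2`-similitudes of `H²(S)`
(`isRationalClass_add_correction`, `isOfHodgeType_add_correction`, `cupProduct_add_correction`,
`cupProduct_neg_add_correction_eq`); X at `(S, S)` gives algebraic `γ₁, γ₂` with `Ξᵢ = [γᵢ]_*`,
and `e = ½(Ξ₁ − Ξ₂) = [½(γ₁ − γ₂)]_*`. (On `T` the two similitudes are `±ε`, the only Hodge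
`2`-similitudes in `ℚ(ε)`; on `NS` both are the Witt isometry `ν : NS_ℚ(2) ≅ NS_ℚ`.)
[cite: Varesco2023, Thm. 2.1 and Rem. 2.2] [cite: Huybrechts2019, §1]
[cite: Huybrechts2016K3, Ch. 1 Prop. 3.5; Ch. 6 Prop. 1.2] -/
theorem realMultiplicationSqrtTwo_algebraic_of_selfTwoSimilitudes
    (hmark : Huybrechts_K3_marking_exists) (hHT : Huybrechts_K3_hodgeTypes_H2)
    (μ : OrientationFamily) (S : SchemeOver ℂ) (hS : IsK3Surface S)
    (hL : ∀ c : complexBetti S (2 * 1), IsRationalClass c → IsOfHodgeType 2 S (2 * 1) 1 1 c →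
      c ∈ algebraicClasses S 1)
    (hX : ∀ (p : complexBetti S (2 * 2)),
      (IsIntegralClass p ∧ ∀ q : complexBetti S (2 * 2), IsIntegralClass q → ∃ n : ℤ, q = n • p) →
      ∀ (ψ : complexBetti S (2 * 1) →ₗ[ℂ] complexBetti S (2 * 1)),
        (∀ x, IsRationalClass x → IsRationalClass (ψ x)) →
        (∀ (i j : ℕ) x, IsOfHodgeType 2 S (2 * 1) i j x → IsOfHodgeType 2 S (2 * 1) i j (ψ x)) →
        (∀ (x y : complexBetti S (2 * 1)) (a : ℂ),
          cupProduct (rfl : 2 * 1 + 2 * 1 = 2 * 2) x y = a • p →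
            cupProduct (rfl : 2 * 1 + 2 * 1 = 2 * 2) (ψ x) (ψ y) = ((2 : ℂ) * a) • p) →
        ∃ γ ∈ algebraicClasses (S ⊗ S) 2, ∀ x : complexBetti S (2 * 1),
          ψ x = complexGysin μ (IsSmoothProjective.tensor_holds hS.1 hS.1) hS.1
            (SemiCartesianMonoidalCategory.fst S S)
            (rfl : 2 * 1 + 2 * 2 + 2 * 2 = 2 * 1 + 2 * (2 + 2))
            (cupProduct (rfl : 2 * 1 + 2 * 2 = 2 * 1 + 2 * 2)
              (complexBetti.map (SemiCartesianMonoidalCategory.snd S S) (2 * 1) x) γ))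
    (e : complexBetti S (2 * 1) →ₗ[ℂ] complexBetti S (2 * 1))
    (he_rat : ∀ x, IsRationalClass x → IsRationalClass (e x))
    (he_type : ∀ (i j : ℕ) x, IsOfHodgeType 2 S (2 * 1) i j x → IsOfHodgeType 2 S (2 * 1) i j (e x))
    (he_adj : ∀ x y : complexBetti S (2 * 1),
      cupProduct (rfl : 2 * 1 + 2 * 1 = 2 * 2) (e x) y = cupProduct (rfl : 2 * 1 + 2 * 1 = 2 * 2) x (e y))
    (he_N : ∀ d ∈ algebraicClasses S 1, e d = 0)
    (he_T : ∀ x : complexBetti S (2 * 1),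
      (∀ d ∈ algebraicClasses S 1, cupProduct (rfl : 2 * 1 + 2 * 1 = 2 * 2) x d = 0) →
        e (e x) = (2 : ℂ) • x) :
    ∃ γ ∈ algebraicClasses (S ⊗ S) 2, ∀ x : complexBetti S (2 * 1),
      e x = complexGysin μ (IsSmoothProjective.tensor_holds hS.1 hS.1) hS.1
        (SemiCartesianMonoidalCategory.fst S S)
        (rfl : 2 * 1 + 2 * 2 + 2 * 2 = 2 * 1 + 2 * (2 + 2))
        (cupProduct (rfl : 2 * 1 + 2 * 2 = 2 * 1 + 2 * 2)
          (complexBetti.map (SemiCartesianMonoidalCategory.snd S S) (2 * 1) x) γ) := by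
  -- a marking of `S`, its `(2,0)`-class `σ = η⁻¹x₀` and the Hodge types of `H²(S)`
  obtain ⟨η, p₀, x₀, hp₀, ⟨hp₀int, hp₀gen, hηint, hηcup, h20, -⟩, ⟨-, hxpos, -⟩⟩ := hmark S hS
  have hσ0 : η.symm x₀ ≠ 0 := fun h0 =>
    ne_zero_of_star_self_re_pos hxpos (by simpa using congrArg η h0)
  obtain ⟨h1, h2, h3⟩ := hHT S hS (η.symm x₀) h20 hσ0
  rw [conjClass_marking_symm η hηint] at h2 h3
  -- `e σ = l σ`, `e σ̄ = l' σ̄`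
  obtain ⟨l, hl⟩ := (h1 (e (η.symm x₀))).1 (he_type 2 0 _ h20)
  have h02 : IsOfHodgeType 2 S (2 * 1) 0 2 (η.symm (star x₀)) := (h2 _).2 ⟨1, (one_smul ℂ _).symm⟩
  obtain ⟨l', hl'⟩ := (h2 (e (η.symm (star x₀)))).1 (he_type 0 2 _ h02)
  -- `(σ.σ̄) ≠ 0`, hence `l = l'`
  have hσσ' : cupProduct (rfl : 2 * 1 + 2 * 1 = 2 * 2) (η.symm x₀) (η.symm (star x₀)) =
      k3Form x₀ (star x₀) • p₀ := by
    rw [hηcup, LinearEquiv.apply_symm_apply, LinearEquiv.apply_symm_apply]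
  have hk : k3Form x₀ (star x₀) ≠ 0 := by
    rw [k3Form_comm]
    intro h0
    rw [h0, Complex.zero_re] at hxpos
    exact lt_irrefl _ hxpos
  have hll' : l = l' := by
    have h := he_adj (η.symm x₀) (η.symm (star x₀))
    rw [hl, hl', LinearMap.map_smul₂, LinearMap.map_smul, hσσ', smul_smul, smul_smul] at h
    exact mul_right_cancel₀ hk (smul_left_injective ℂ hp₀ h)
  by_cases hl0 : l = 0
  · /- DEGENERATE CASE `e σ = e σ̄ = 0`: then `e = 0`. -/
    have heσ : e (η.symm x₀) = 0 := by rw [hl, hl0, zero_smul]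
    have heσ' : e (η.symm (star x₀)) = 0 := by rw [hl', ← hll', hl0, zero_smul]
    -- every `e x` is of type `(1,1)`
    have h11 : ∀ x, IsOfHodgeType 2 S (2 * 1) 1 1 (e x) := fun x =>
      (h3 _).2 ⟨by rw [he_adj, heσ, map_zero], by rw [he_adj, heσ', map_zero]⟩
    -- so `e (e x) = 0` for rational `x` (Lefschetz (1,1): `e x ∈ NS`), hence for all `x`
    have hee_rat : ∀ x, IsRationalClass x → e (e x) = 0 := fun x hx =>
      he_N _ (hL (e x) (he_rat x hx) (h11 x))
    have hee : ∀ x, e (e x) = 0 := by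
      intro x
      have hx : x = ∑ j, (η x) j • η.symm (fun i => ((Pi.single j (1 : ℤ) : K3Index → ℤ) i : ℂ)) := by
        apply η.injective
        rw [map_sum]
        simp_rw [map_smul, LinearEquiv.apply_symm_apply]
        exact pi_eq_sum_single (η x)
      rw [hx, map_sum, map_sum]
      refine Finset.sum_eq_zero fun j _ => ?_
      rw [map_smul, map_smul,
        hee_rat _ ((hηint _).2 ⟨Pi.single j 1, η.apply_symm_apply _⟩).isRationalClass, smul_zero]
    -- `NS^⊥ = 0`
    have hT0 : ∀ x : complexBetti S (2 * 1),
        (∀ d ∈ algebraicClasses S 1, cupProduct (rfl : 2 * 1 + 2 * 1 = 2 * 2) x d = 0) → x = 0 := by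
      intro x hx
      have h := he_T x hx
      rw [hee] at h
      exact (smul_eq_zero.1 h.symm).resolve_left two_ne_zero
    -- `e x ∈ NS^⊥`, so `e = 0`
    have he0 : ∀ x, e x = 0 := fun x =>
      hT0 (e x) fun d hd => by rw [he_adj, he_N d hd, map_zero]
    refine ⟨0, Submodule.zero_mem _, fun x => ?_⟩
    rw [he0, map_zero, map_zero]
  · /- MAIN CASE `l ≠ 0`: `NS ⊥ σ, σ̄`, Witt correction, X twice, `e = ½(Ξ₁ − Ξ₂)`. -/
    have hl'0 : l' ≠ 0 := hll' ▸ hl0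
    have horth : ∀ d ∈ algebraicClasses S 1,
        cupProduct (rfl : 2 * 1 + 2 * 1 = 2 * 2) d (η.symm x₀) = 0 ∧
          cupProduct (rfl : 2 * 1 + 2 * 1 = 2 * 2) d (η.symm (star x₀)) = 0 := by
      intro d hd
      refine ⟨?_, ?_⟩
      · have h := he_adj d (η.symm x₀)
        rw [he_N d hd, map_zero, LinearMap.zero_apply, hl, LinearMap.map_smul] at h
        exact (smul_eq_zero.1 h.symm).resolve_left hl0
      · have h := he_adj d (η.symm (star x₀))
        rw [he_N d hd, map_zero, LinearMap.zero_apply, hl', LinearMap.map_smul] at h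
        exact (smul_eq_zero.1 h.symm).resolve_left hl'0
    have horth' : ∀ w : K3Index → ℚ, η.symm (fun j => (w j : ℂ)) ∈ algebraicClasses S 1 →
        k3Form (fun j => (w j : ℂ)) x₀ = 0 ∧ k3Form (fun j => (w j : ℂ)) (star x₀) = 0 := by
      intro w hw
      obtain ⟨hw1, hw2⟩ := horth _ hw
      rw [hηcup, LinearEquiv.apply_symm_apply, LinearEquiv.apply_symm_apply, smul_eq_zero] at hw1 hw2
      exact ⟨hw1.resolve_right hp₀, hw2.resolve_right hp₀⟩
    -- the rational correction (Witt)
    obtain ⟨m, a, b, ξ, ha, hb, hξ, hKB⟩ :=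
      exists_ratCorrection hS η p₀ hp₀ hηint hηcup e he_rat he_adj he_N he_T
    -- the correction `ν̃ = Σᵢ (η(·).aᵢ) η⁻¹bᵢ`
    set ψ : Fin m → (complexBetti S (2 * 1) →ₗ[ℂ] complexBetti S (2 * 1)) := fun i =>
      ((k3FormC.flip fun j => (a i j : ℂ)) ∘ₗ η.toLinearMap).smulRight (η.symm fun j => (b i j : ℂ))
      with hψdef
    have hψ : ∀ i x, ψ i x = k3Form (η x) (fun j => (a i j : ℂ)) • η.symm (fun j => (b i j : ℂ)) := by
      intro i x
      rw [hψdef]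
      change ((k3FormC.flip fun j => (a i j : ℂ)) ∘ₗ η.toLinearMap) x • η.symm (fun j => (b i j : ℂ)) = _
      rw [LinearMap.comp_apply, LinearEquiv.coe_coe, LinearMap.BilinForm.flip_apply, k3FormC_apply]
    set ν : complexBetti S (2 * 1) →ₗ[ℂ] complexBetti S (2 * 1) := ∑ i, ψ i with hνdef
    have hν : ∀ x, ν x = ∑ i, k3Form (η x) (fun j => (a i j : ℂ)) • η.symm (fun j => (b i j : ℂ)) := by
      intro x
      rw [hνdef, LinearMap.sum_apply]
      exact Finset.sum_congr rfl fun i _ => hψ i x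
    have heb : ∀ i, e (η.symm fun j => (b i j : ℂ)) = 0 := fun i => he_N _ (hb i)
    have hrat₁ := isRationalClass_add_correction hS η hηint e ν a b ξ hν hKB
    have hcup₁ := cupProduct_add_correction η p₀ hp₀ hηcup e ν a b ξ hν hKB hξ
    -- X at the pair `(S, S)` for `Ξ₁ = e + ν̃`
    obtain ⟨γ₁, hγ₁, hΞ₁⟩ := hX p₀ ⟨hp₀int, hp₀gen⟩ (e + ν) hrat₁
      (isOfHodgeType_add_correction hS η p₀ hηcup x₀ h1 h2 h3 e ν he_type a b hν
        (fun i => horth' _ (ha i)) (fun i => horth' _ (hb i)))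
      hcup₁
    -- X at the pair `(S, S)` for the mirror `Ξ₂ = -e + ν̃`
    obtain ⟨γ₂, hγ₂, hΞ₂⟩ := hX p₀ ⟨hp₀int, hp₀gen⟩ (-e + ν)
      (fun x hx => by
        have hx2 : (-e + ν) x = (e + ν) x + ((-2 : ℚ) : ℂ) • e x := by
          rw [LinearMap.add_apply, LinearMap.neg_apply, LinearMap.add_apply, Rat.cast_neg,
            Rat.cast_ofNat]
          module
        rw [hx2]
        exact (hrat₁ x hx).add ((he_rat x hx).smul _))
      (isOfHodgeType_add_correction hS η p₀ hηcup x₀ h1 h2 h3 (-e) ν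
        (fun i j x hx => by rw [LinearMap.neg_apply]; exact isOfHodgeType_neg (he_type i j x hx))
        a b hν (fun i => horth' _ (ha i)) (fun i => horth' _ (hb i)))
      (fun x y c hxy => by
        rw [cupProduct_neg_add_correction_eq η e ν he_adj a b hν heb x y]
        exact hcup₁ x y c hxy)
    -- `e = ½ (Ξ₁ − Ξ₂)`
    have h := induced_smul (IsSmoothProjective.tensor_holds hS.1 hS.1) hS.1
      (rfl : 2 * 1 + 2 * 2 = 2 * 1 + 2 * 2) (rfl : 2 * 1 + 2 * 2 + 2 * 2 = 2 * 1 + 2 * (2 + 2))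
      (1 / 2 : ℂ)
      (induced_sub (IsSmoothProjective.tensor_holds hS.1 hS.1) hS.1
        (rfl : 2 * 1 + 2 * 2 = 2 * 1 + 2 * 2) (rfl : 2 * 1 + 2 * 2 + 2 * 2 = 2 * 1 + 2 * (2 + 2))
        ⟨γ₁, hγ₁, hΞ₁⟩ ⟨γ₂, hγ₂, hΞ₂⟩)
    have he : (1 / 2 : ℂ) • ((e + ν) - (-e + ν)) = e := by
      rw [show (e + ν) - (-e + ν) = (2 : ℂ) • e by module, smul_smul]
      norm_num
    rwa [he] at h

/-- **Real multiplication by `√2` on projective K3 surfaces is algebraic (the route decl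
`RealMultiplicationSqrtTwoAlgebraic`), granted X = Sim₂(K3) (used at the pairs `(S, S)` only),
Lefschetz `(1,1)` for K3 surfaces, markings (`Huybrechts_K3_marking_exists`) and the Hodge types of
`H²(K3)` (`Huybrechts_K3_hodgeTypes_H2`)** — `realMultiplicationSqrtTwo_algebraic_of_selfTwoSimilitudes`
surface by surface. [cite: Varesco2023, Thm. 2.1 and Rem. 2.2] [cite: Huybrechts2019, §1] -/
theorem realMultiplicationSqrtTwoAlgebraic_of_marking_of_hodgeTypes
    (hX : Theses.NikulinTwinTransport.TwinSimilitudeAlgebraic)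
    (hL : Theses.NikulinTwinTransport.LefschetzOneOneK3)
    (hmark : Huybrechts_K3_marking_exists) (hHT : Huybrechts_K3_hodgeTypes_H2) :
    Theses.NikulinTwinTransport.RealMultiplicationSqrtTwoAlgebraic :=
  fun μ hμ S hS e he_rat he_type he_adj he_N he_T =>
    realMultiplicationSqrtTwo_algebraic_of_selfTwoSimilitudes hmark hHT μ S hS (hL S hS)
      (fun p hp ψ => hX μ hμ S S hS hS p p hp hp ψ) e he_rat he_type he_adj he_N he_T

end Marked

/-- **The route's glue `RealMultiplicationGlue` (item stmt-HodgeConjecture-13681,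
`TwinSimilitudeAlgebraic → HodgeIsometryAlgebraic → TwinExists → LefschetzOneOneK3 →
RealMultiplicationSqrtTwoAlgebraic`) from the two named K3 facts alone** — markings
(`Huybrechts_K3_marking_exists`) and the Hodge types of `H²(K3)` (`Huybrechts_K3_hodgeTypes_H2`):
of the glue's hypotheses, X and Lefschetz `(1,1)` are used; Buskin's theorem and the universal
twin are not; no divisor correspondence, fibre integration or coniveau fact enters.
[cite: Varesco2023, Thm. 2.1 and Rem. 2.2] [cite: Huybrechts2019, §1] -/
theorem realMultiplicationGlue_of_marking_of_hodgeTypes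
    (hmark : Huybrechts_K3_marking_exists) (hHT : Huybrechts_K3_hodgeTypes_H2) :
    Theses.NikulinTwinTransport.RealMultiplicationGlue :=
  fun hX _ _ hL => realMultiplicationSqrtTwoAlgebraic_of_marking_of_hodgeTypes hX hL hmark hHT

/-- **The route's frame item `Assembly` (stmt-HodgeConjecture-13942, `TwinSimilitudeAlgebraic →
HodgeIsometryAlgebraic → TwinExists → LefschetzOneOneK3 → SectorComplement → HodgeConjecture`)
from `SquareGlue` and the two named K3 facts.** [cite: Varesco2023, Thm. 2.1 and Rem. 2.2] -/
theorem assembly_of_squareGlue_of_marking_of_hodgeTypes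
    (hSq : Theses.NikulinTwinTransport.SquareGlue)
    (hmark : Huybrechts_K3_marking_exists) (hHT : Huybrechts_K3_hodgeTypes_H2) :
    Theses.NikulinTwinTransport.Assembly :=
  fun hX _ _ h₁ h₇ => h₇ (hSq
    (realMultiplicationSqrtTwoAlgebraic_of_marking_of_hodgeTypes hX h₁ hmark hHT) h₁)

end Summit.HodgeConjecture.HodgeConjecture.Theorems.NikulinTwinTransport

end
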